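import Summits.BirchSwinnertonDyer.BirchSwinnertonDyer.Theorems.ByReductionTypeAtTwoProp514DevissageBridge
import HarnessLib

/-!
# Greenberg's Prop. 5.14 at `p = 2` as a kernel theorem, file E2: the residual dévissage WITH the archimedean
# condition — the two finiteness reductions

Cell `bsd-2adic` (run/shared/lean/pub/bsd-2adic/), seat `bsd-2adic-t42` GEN 27 (road «H514-KERNEL», memo
`t42/DESIGN-T42-ADDENDUM-31.md`; `--supports` stmt-BirchSwinnertonDyer-19923). HONEST FRAMING: research route;
theorems only (no `def`, no named fact, nothing booked); BSD is not proved by any of this.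

WHAT. In case «`Φ` ramified at `2`, not odd» (`Φ = C₂[2]`, `P ∉ C_∞`) the `Φ`-side classes of the residual
structure `R = {y ∈ S^{Σ₀}_{E[2]}(ℚ_∞) : α y strict at ∞}` are homomorphisms `Γ_∞ → ℤ/2` unramified outside
`Σ₀ ∪ {2}` which KILL EVERY COMPLEX CONJUGATION, and the `Ψ`-side classes are unramified at every finite place
outside `Σ₀`; in case «`Φ` odd, unramified at `2`» (`Φ ∩ C₂ = 0`, `Φ = C_∞[2]`) the roles are exchanged
(Greenberg, LNM 1716, proofs of Prop. 5.14 and Prop. 5.10). THIS FILE proves, for an arbitrary discrete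
`Γ_ℚ`-module `M` in place of `E[2^∞]` (normal `H ≤ Γ_ℚ`, stable line `S ≤ M[n]` on which — and on whose
quotient — `H` acts trivially): **`finite_archGvSelmer_torsion_of_plus_eq`** (case `Φ = M⁺[n]`) and
**`finite_archGvSelmer_torsion_of_bijective`** (case `Φ ≅ M[n]/M⁺[n]`): the set
`{y ∈ S^{Σ₀}_{M[n]}(H) : conj_σ (α y) ∈ infKer_w ∀ w σ}` is FINITE as soon as the corresponding two sets of
continuous homomorphisms `H → Φ`, `H → Ψ` are (file E1 supplies the bridges; the character-side finiteness is
`IwasawaTheory/CyclotomicTwoTowerQuadraticCharactersFinite`; the curve-side assembly is file G).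

References: [GreenbergLNM1716] §5, proof of Prop. 5.14 (p. 122) and of Prop. 5.10 (pp. 147–148);
[GreenbergVatsal2000] §2 pp. 28–30; [Matsuno2008] Lemma 2.5, Prop. 4.4.
-/

set_option autoImplicit false
set_option linter.dupNamespace false

noncomputable section

open scoped Classical AddSubgroup Pointwise

universe u

namespace Summit.BirchSwinnertonDyer.BirchSwinnertonDyer.Theorems.Prop514AtTwo

open NumberField IsDedekindDomain Field Literature.NumberTheory.GaloisRepresentations
  Literature.NumberTheory.EllipticCurves Literature.NumberTheory.EllipticCurves.GreenbergSelmer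
  Summit.BirchSwinnertonDyer.Rank1Residual.X2.TorsionComparison
  Summit.BirchSwinnertonDyer.Rank1Residual.X2.GreenbergVatsalTorsion
  Summit.BirchSwinnertonDyer.Rank1Residual.X2.ResidualDevissageModules
  Summit.BirchSwinnertonDyer.Rank1Residual.X2.ResidualDevissageSelmer
  Summit.BirchSwinnertonDyer.BirchSwinnertonDyer.Theorems.MultTransportAtTwo

/-! ## §3 The two finiteness reductions for the archimedean-cut residual structure -/

section Devissage

open Literature.NumberTheory.EllipticCurves.GreenbergVatsal2000 hiding unramifiedKer
open Summit.BirchSwinnertonDyer.Rank1Residual.X2.ResidualSelmerFinite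
  Summit.BirchSwinnertonDyer.Rank1Residual.X2.GreenbergVatsalTateDatumCofree

variable (H : Subgroup (absoluteGaloisGroup ℚ)) [H.Normal]
  {M : Type} [AddCommGroup M] [DistribMulAction (absoluteGaloisGroup ℚ) M] [TopologicalSpace M]
  [DiscreteTopology M] (n : ℕ) (S : StableSubgroup (absoluteGaloisGroup ℚ) ↥(M[(n : ℤ)]))
  (htrivΦ : ∀ (h : H) (x : S.Sub), h • x = x) (htrivΨ : ∀ (h : H) (y : S.Quot), h • y = y)
  (p : ℕ) (N : Data ℚ M p) (S₀ : Set (HeightOneSpectrum (𝓞 ℚ)))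
  (hM : ∀ m : ↥(M[(n : ℤ)]), Continuous fun g : absoluteGaloisGroup ℚ ↦ g • m)
  (hunr : ∀ v : HeightOneSpectrum (𝓞 ℚ), v ∉ S₀ → ((p : ℕ) : 𝓞 ℚ) ∉ v.asIdeal →
    ∀ x ∈ inertia v, ∀ m : ↥(M[(n : ℤ)]), x • m = m)

/-- The archimedean-cut residual structure `{y ∈ S^{Σ₀}_{M[n]}(H) : conj_σ (α y) ∈ infKer_w ∀ w σ}` is (the carrier
of) the subgroup `S^{Σ₀}_{M[n]}(H) ⊓ ⨅_{w,σ} comap (conj_σ ∘ α) infKer_w`. [folklore] -/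
theorem setOf_archGvSelmer_torsion_eq :
    {y : subgroupH1 H ↥(M[(n : ℤ)]) |
        y ∈ gvSelmer H ↥(M[(n : ℤ)]) p (torsionData N n) S₀ ∧
          ∀ (w : InfinitePlace ℚ) (σ : absoluteGaloisGroup ℚ),
            conjH1 H M σ (torsionToH1 H M n y) ∈ infKer H M w} =
      ↑(gvSelmer H ↥(M[(n : ℤ)]) p (torsionData N n) S₀ ⊓
        ⨅ (w : InfinitePlace ℚ) (σ : absoluteGaloisGroup ℚ),
          (infKer H M w).comap ((conjH1 H M σ).comp (torsionToH1 H M n))) := by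
  ext y
  simp only [Set.mem_setOf_eq, SetLike.mem_coe, AddSubgroup.mem_inf, AddSubgroup.mem_iInf,
    AddSubgroup.mem_comap, AddMonoidHom.coe_comp, Function.comp_apply]

include htrivΦ htrivΨ hM hunr in
/-- **CASE `Φ = M⁺[n]` (Greenberg: «`Φ` ramified at `2`, not odd»): the archimedean-cut residual structure is
FINITE as soon as (i) the continuous homomorphisms `H → Φ` unramified outside `S₀ ∪ {v ∣ p}` and killing every
complex conjugation, and (ii) the continuous homomorphisms `H → Ψ` unramified at every finite place outside `S₀`,
are finite in number.**  Proof: `q_*` maps the structure into `S^{Σ₀}_Ψ(H)` (Greenberg's condition at `v ∣ p` for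
the datum `M⁺[n] = ker q` IS unramifiedness of `q_* y`), whose homomorphisms are the set (ii); its kernel there
consists of `i_* a` with `a` unramified outside `S₀ ∪ {v ∣ p}` (exactness + backward transport) and killing the
complex conjugations (§2, hypothesis `hB`: no coboundary value is a non-zero point of `Φ`), the set (i).
[cite: GreenbergLNM1716, §5 proof of Prop. 5.14 (p. 122) and of Prop. 5.10 (pp. 147–148)] [cite: GreenbergVatsal2000, §2 pp. 28–30] -/
theorem finite_archGvSelmer_torsion_of_plus_eq
    (hplus : ∀ (v : HeightOneSpectrum (𝓞 ℚ)) (hv : ((p : ℕ) : 𝓞 ℚ) ∈ v.asIdeal),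
      (torsionData N n v hv).plus = S.toAddSubgroup)
    (hB : ∀ u : absoluteGaloisGroup ℚ, (∃ φ : ℚ →+* ℝ, IsComplexConjugation φ u) →
      ∀ (b : M) (x : S.Sub), ((S.incl x : M[(n : ℤ)]) : M) = u • b - b → x = 0)
    (hΦfin : Set.Finite {f : H → S.Sub |
      f ∈ unramifiedHoms H S.Sub (S₀ ∪ {v | ((p : ℕ) : 𝓞 ℚ) ∈ v.asIdeal}) ∧
        ∀ u : H, (∃ φ : ℚ →+* ℝ, IsComplexConjugation φ (u : absoluteGaloisGroup ℚ)) → f u = 0})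
    (hΨfin : (unramifiedHoms H S.Quot S₀).Finite) :
    Set.Finite {y : subgroupH1 H ↥(M[(n : ℤ)]) |
        y ∈ gvSelmer H ↥(M[(n : ℤ)]) p (torsionData N n) S₀ ∧
          ∀ (w : InfinitePlace ℚ) (σ : absoluteGaloisGroup ℚ),
            conjH1 H M σ (torsionToH1 H M n y) ∈ infKer H M w} := by
  rw [setOf_archGvSelmer_torsion_eq]
  set A : AddSubgroup (subgroupH1 H ↥(M[(n : ℤ)])) :=
    gvSelmer H ↥(M[(n : ℤ)]) p (torsionData N n) S₀ ⊓
      ⨅ (w : InfinitePlace ℚ) (σ : absoluteGaloisGroup ℚ),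
        (infKer H M w).comap ((conjH1 H M σ).comp (torsionToH1 H M n)) with hAdef
  -- membership in `A`, unfolded
  have hmemA : ∀ {y : subgroupH1 H ↥(M[(n : ℤ)])}, y ∈ A →
      y ∈ datumSelmer H ↥(M[(n : ℤ)]) p (torsionData N n) S₀ ∧
        ∀ (w : InfinitePlace ℚ) (σ : absoluteGaloisGroup ℚ),
          conjH1 H M σ (torsionToH1 H M n y) ∈ infKer H M w := by
    intro y hy
    obtain ⟨h1, h2⟩ := AddSubgroup.mem_inf.1 hy
    rw [gvSelmer_eq_datumSelmer] at h1
    simp only [AddSubgroup.mem_iInf, AddSubgroup.mem_comap, AddMonoidHom.coe_comp,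
      Function.comp_apply] at h2
    exact ⟨h1, h2⟩
  have hN' : ∀ (v : HeightOneSpectrum (𝓞 ℚ)) (hv : ((p : ℕ) : 𝓞 ℚ) ∈ v.asIdeal),
      (torsionData N n v hv).plus = S.proj.ker := fun v hv ↦ by rw [S.ker_proj]; exact hplus v hv
  let F : A →+ subgroupH1 H S.Quot := (subH1 H S.proj S.proj_smul).comp A.subtype
  -- the range: homomorphisms `H → Ψ` unramified at every finite place outside `S₀`
  haveI : Finite F.range := by
    have hfin : Set.Finite {c : subgroupH1 H S.Quot |
        (fun u : H ↦ evalH1 htrivΨ u c) ∈ unramifiedHoms H S.Quot S₀} :=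
      finite_of_finite_image_evalH1 H htrivΨ (hΨfin.subset (by rintro _ ⟨c, hc, rfl⟩; exact hc))
    refine Set.finite_coe_iff.mpr (hfin.subset ?_)
    rintro _ ⟨y, rfl⟩
    exact evalH1_mem_unramifiedHoms_of_mem_quotSelmer H htrivΨ p S₀
      (subH1_mem_quotSelmer S.proj_smul hN' S.proj_surjective (hmemA y.2).1)
  -- the kernel: `i_* a`, `a` unramified outside `S₀ ∪ {v ∣ p}` and killing the complex conjugations
  haveI : Finite F.ker := by
    have hTΦ : Set.Finite {a : subgroupH1 H S.Sub | a ∈ unramifiedOutside H S.Sub p S₀ ∧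
        ∀ u : H, (∃ φ : ℚ →+* ℝ, IsComplexConjugation φ (u : absoluteGaloisGroup ℚ)) →
          evalH1 htrivΦ u a = 0} := by
      refine finite_of_finite_image_evalH1 H htrivΦ (hΦfin.subset ?_)
      rintro _ ⟨a, ⟨ha, hacc⟩, rfl⟩
      exact ⟨evalH1_mem_unramifiedHoms_of_mem_unramifiedOutside H htrivΦ p S₀ ha, hacc⟩
    haveI := hTΦ.to_subtype
    have key : ∀ c : F.ker, ∃ a : {a : subgroupH1 H S.Sub | a ∈ unramifiedOutside H S.Sub p S₀ ∧
        ∀ u : H, (∃ φ : ℚ →+* ℝ, IsComplexConjugation φ (u : absoluteGaloisGroup ℚ)) →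
          evalH1 htrivΦ u a = 0},
        subH1 H S.incl S.incl_smul (a : subgroupH1 H S.Sub) = ((c : A) : subgroupH1 H ↥(M[(n : ℤ)])) := by
      intro c
      have hc0 : subH1 H S.proj S.proj_smul ((c : A) : subgroupH1 H ↥(M[(n : ℤ)])) = 0 :=
        (AddMonoidHom.mem_ker).1 c.2
      obtain ⟨hcA, harch⟩ := hmemA (c : A).2
      obtain ⟨a, ha, hac⟩ := exists_mem_unramifiedOutside_subH1_eq (hi := S.incl_smul) S.proj_smul hM
        S.incl_injective S.proj_surjective S.mem_range_incl_of_proj_eq_zero S.proj_incl hunr hcA hc0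
      refine ⟨⟨a, ha, fun u hu ↦ ?_⟩, hac⟩
      refine evalH1_eq_zero_of_arch_of_incl H n S htrivΦ hB (a := a) (fun w σ ↦ ?_) u hu
      rw [hac]
      exact harch w σ
    choose g hg using key
    refine Finite.of_injective g fun c d hcd ↦ ?_
    have h := hg c
    rw [hcd, hg d] at h
    exact Subtype.ext (Subtype.ext h.symm)
  haveI : Finite A := finite_of_finite_ker_of_finite_range F
  exact Set.toFinite _

include htrivΦ htrivΨ hM hunr in
/-- **CASE `Φ ≅ M[n]/M⁺[n]` (Greenberg: «`Φ` odd, unramified at `2»): the archimedean-cut residual structure is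
FINITE as soon as (i) the continuous homomorphisms `H → Φ` unramified at every finite place outside `S₀`, and
(ii) the continuous homomorphisms `H → Ψ` unramified outside `S₀ ∪ {v ∣ p}` and killing every complex conjugation,
are finite in number.**  Proof: `q_*` maps the structure into `H¹(ℚ_Σ/H, Ψ)` and the images kill the complex
conjugations (§2, hypothesis `hA`: every `n`-torsion coboundary value lies in `Φ`), the set (ii); its kernel
consists of `i_* a` with `a` unramified outside `S₀ ∪ {v ∣ p}` and ALSO at `v ∣ p` (Greenberg's condition on
`i_* a` with `Φ ≅ M[n]/M⁺[n]`, tree `mem_unramifiedKer_of_subH1_mem_greenbergKer`), the set (i).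
[cite: GreenbergLNM1716, §5 proof of Prop. 5.14 (p. 122) and of Prop. 5.10 (p. 148)] [cite: GreenbergVatsal2000, §2 pp. 28–30] -/
theorem finite_archGvSelmer_torsion_of_bijective
    (hbij : ∀ (v : HeightOneSpectrum (𝓞 ℚ)) (hv : ((p : ℕ) : 𝓞 ℚ) ∈ v.asIdeal),
      Function.Bijective fun x : S.Sub ↦ (torsionData N n v hv).grMk (S.incl x))
    (hA : ∀ u : absoluteGaloisGroup ℚ, (∃ φ : ℚ →+* ℝ, IsComplexConjugation φ u) →
      ∀ (b : M) (m : ↥(M[(n : ℤ)])), (m : M) = u • b - b → S.proj m = 0)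
    (hΦfin : (unramifiedHoms H S.Sub S₀).Finite)
    (hΨfin : Set.Finite {f : H → S.Quot |
      f ∈ unramifiedHoms H S.Quot (S₀ ∪ {v | ((p : ℕ) : 𝓞 ℚ) ∈ v.asIdeal}) ∧
        ∀ u : H, (∃ φ : ℚ →+* ℝ, IsComplexConjugation φ (u : absoluteGaloisGroup ℚ)) → f u = 0}) :
    Set.Finite {y : subgroupH1 H ↥(M[(n : ℤ)]) |
        y ∈ gvSelmer H ↥(M[(n : ℤ)]) p (torsionData N n) S₀ ∧
          ∀ (w : InfinitePlace ℚ) (σ : absoluteGaloisGroup ℚ),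
            conjH1 H M σ (torsionToH1 H M n y) ∈ infKer H M w} := by
  rw [setOf_archGvSelmer_torsion_eq]
  set A : AddSubgroup (subgroupH1 H ↥(M[(n : ℤ)])) :=
    gvSelmer H ↥(M[(n : ℤ)]) p (torsionData N n) S₀ ⊓
      ⨅ (w : InfinitePlace ℚ) (σ : absoluteGaloisGroup ℚ),
        (infKer H M w).comap ((conjH1 H M σ).comp (torsionToH1 H M n)) with hAdef
  have hmemA : ∀ {y : subgroupH1 H ↥(M[(n : ℤ)])}, y ∈ A →
      y ∈ datumSelmer H ↥(M[(n : ℤ)]) p (torsionData N n) S₀ ∧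
        ∀ (w : InfinitePlace ℚ) (σ : absoluteGaloisGroup ℚ),
          conjH1 H M σ (torsionToH1 H M n y) ∈ infKer H M w := by
    intro y hy
    obtain ⟨h1, h2⟩ := AddSubgroup.mem_inf.1 hy
    rw [gvSelmer_eq_datumSelmer] at h1
    simp only [AddSubgroup.mem_iInf, AddSubgroup.mem_comap, AddMonoidHom.coe_comp,
      Function.comp_apply] at h2
    exact ⟨h1, h2⟩
  let F : A →+ subgroupH1 H S.Quot := (subH1 H S.proj S.proj_smul).comp A.subtype
  -- the range: homomorphisms `H → Ψ` unramified outside `S₀ ∪ {v ∣ p}`, killing the complex conjugations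
  haveI : Finite F.range := by
    have hfin : Set.Finite {c : subgroupH1 H S.Quot |
        (fun u : H ↦ evalH1 htrivΨ u c) ∈ unramifiedHoms H S.Quot (S₀ ∪ {v | ((p : ℕ) : 𝓞 ℚ) ∈ v.asIdeal}) ∧
          ∀ u : H, (∃ φ : ℚ →+* ℝ, IsComplexConjugation φ (u : absoluteGaloisGroup ℚ)) →
            evalH1 htrivΨ u c = 0} :=
      finite_of_finite_image_evalH1 H htrivΨ (hΨfin.subset (by rintro _ ⟨c, hc, rfl⟩; exact hc))
    refine Set.finite_coe_iff.mpr (hfin.subset ?_)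
    rintro _ ⟨y, rfl⟩
    obtain ⟨hyA, harch⟩ := hmemA y.2
    exact ⟨evalH1_mem_unramifiedHoms_of_mem_unramifiedOutside H htrivΨ p S₀
      (subH1_mem_unramifiedOutside (hi := S.proj_smul) p S₀
        (datumSelmer_le_unramifiedOutside H _ p (torsionData N n) S₀ hyA)),
      fun u hu ↦ evalH1_proj_eq_zero_of_arch H n S htrivΨ hA harch u hu⟩
  -- the kernel: `i_* a` with `a` unramified at EVERY finite place outside `S₀`
  haveI : Finite F.ker := by
    have hTΦ : Set.Finite {a : subgroupH1 H S.Sub | a ∈ quotSelmer H S.Sub p S₀} := by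
      refine finite_of_finite_image_evalH1 H htrivΦ (hΦfin.subset ?_)
      rintro _ ⟨a, ha, rfl⟩
      exact evalH1_mem_unramifiedHoms_of_mem_quotSelmer H htrivΦ p S₀ ha
    haveI := hTΦ.to_subtype
    have key : ∀ c : F.ker, ∃ a : {a : subgroupH1 H S.Sub | a ∈ quotSelmer H S.Sub p S₀},
        subH1 H S.incl S.incl_smul (a : subgroupH1 H S.Sub) = ((c : A) : subgroupH1 H ↥(M[(n : ℤ)])) := by
      intro c
      have hc0 : subH1 H S.proj S.proj_smul ((c : A) : subgroupH1 H ↥(M[(n : ℤ)])) = 0 :=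
        (AddMonoidHom.mem_ker).1 c.2
      obtain ⟨hcA, -⟩ := hmemA (c : A).2
      obtain ⟨a, ha, hac⟩ := exists_mem_unramifiedOutside_subH1_eq (hi := S.incl_smul) S.proj_smul hM
        S.incl_injective S.proj_surjective S.mem_range_incl_of_proj_eq_zero S.proj_incl hunr hcA hc0
      refine ⟨⟨a, ?_⟩, hac⟩
      rw [Set.mem_setOf_eq, mem_quotSelmer_iff]
      refine ⟨ha, fun v hv σ ↦ ?_⟩
      refine mem_unramifiedKer_of_subH1_mem_greenbergKer (hi := S.incl_smul) (torsionData N n v hv)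
        (hbij v hv) ?_
      rw [← conjH1_subH1, hac]
      exact ((mem_datumSelmer_iff _).1 hcA).2 v hv σ
    choose g hg using key
    refine Finite.of_injective g fun c d hcd ↦ ?_
    have h := hg c
    rw [hcd, hg d] at h
    exact Subtype.ext (Subtype.ext h.symm)
  haveI : Finite A := finite_of_finite_ker_of_finite_range F
  exact Set.toFinite _

end Devissage


end Summit.BirchSwinnertonDyer.BirchSwinnertonDyer.Theorems.Prop514AtTwo

end
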